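import Mathlib

/-!
# Towards (Dickson), p′-case (D0): centralisers of non-scalar `2 × 2` matrices
# (crux `LevelGradedCohnUmans.GradedDesignFamily`, stmt-MatrixMultiplication-7610; negative side,
# line `quadratic-extension-level-one-cell`, unit b2b-lgcu-subfield gen 18)

HONEST FRAMING.  After gen 18, `¬ stub_subfieldCell ⇐ (BGT) ∧ (Dickson)`
(`not_subfieldCell_of_BGT_Dickson`).  The plan for (Dickson) recorded in the cell doc
(SUBFIELD.md §23.6) has a p′-case (D0) whose first step is: a non-central element `g` of a
subgroup `L ≤ SL₂(K)` has an ABELIAN centraliser of order `≤ 2|K|`.  This file lands exactly that,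
with no field extension:

* `fin_two_comm_exists_smul_add` — the centraliser in `M₂(K)` of a non-scalar `g` is
  `K[g] = {a•1 + b•g}` (so it is commutative);
* `fin_two_comm_same_charpoly` — if moreover the characteristic polynomial of `g` is separable,
  the only elements of `K[g]` with the trace and determinant of `g` are `g` and `(tr g)•1 − g`
  (so the normaliser of such a centraliser class has index `≤ 2` over it);
* `fin_two_card_quadratic_le_two` — a monic quadratic has at most two roots (three-roots trick);
* `card_comm_det_one_le` — any finite set of determinant-one matrices commuting with a non-scalar
  `g` has at most `2|K|` elements (`det (a•1 + b•g) = 1` is a monic quadratic in `a` for each `b`).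

Support lemmas only; NOT summit progress.  Sorry-free. [folklore]
-/

set_option linter.dupNamespace false

open Matrix

namespace Summit.MatrixMultiplication.MatrixMultiplication.Theorems.GradedDesignFamily.Negative

/-- The centraliser of a non-scalar `2 × 2` matrix `g` over a field is `K[g] = {a•1 + b•g}`.
[folklore] -/
theorem fin_two_comm_exists_smul_add {K : Type} [Field K] (g X : Matrix (Fin 2) (Fin 2) K)
    (hg : g 0 1 ≠ 0 ∨ g 1 0 ≠ 0 ∨ g 0 0 ≠ g 1 1) (hX : X * g = g * X) :
    ∃ a b : K, X = a • (1 : Matrix (Fin 2) (Fin 2) K) + b • g := by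
  have h00 := congrFun (congrFun hX 0) 0
  have h01 := congrFun (congrFun hX 0) 1
  have h10 := congrFun (congrFun hX 1) 0
  have h11 := congrFun (congrFun hX 1) 1
  simp only [Matrix.mul_apply, Fin.sum_univ_two] at h00 h01 h10 h11
  rcases hg with hq | hr | hps
  · refine ⟨X 0 0 - X 0 1 / g 0 1 * g 0 0, X 0 1 / g 0 1, ?_⟩
    ext i j
    fin_cases i <;> fin_cases j
    · simp
    · simp [hq]
    · simp
      field_simp
      linear_combination -h00
    · simp
      field_simp
      linear_combination -h01
  · refine ⟨X 0 0 - X 1 0 / g 1 0 * g 0 0, X 1 0 / g 1 0, ?_⟩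
    ext i j
    fin_cases i <;> fin_cases j
    · simp
    · simp
      field_simp
      linear_combination h00
    · simp [hr]
    · simp
      field_simp
      linear_combination h10
  · by_cases hq : g 0 1 = 0
    · by_cases hr : g 1 0 = 0
      · have hps' : g 0 0 - g 1 1 ≠ 0 := sub_ne_zero.mpr hps
        have hy : X 0 1 = 0 := by
          have h : X 0 1 * (g 1 1 - g 0 0) = 0 := by rw [hq] at h01; linear_combination h01
          rcases mul_eq_zero.mp h with h | h
          · exact h
          · exact absurd (by linear_combination -h) hps'
        have hz : X 1 0 = 0 := by
          have h : X 1 0 * (g 0 0 - g 1 1) = 0 := by rw [hr] at h10; linear_combination h10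
          rcases mul_eq_zero.mp h with h | h
          · exact h
          · exact absurd h hps'
        refine ⟨X 0 0 - (X 0 0 - X 1 1) / (g 0 0 - g 1 1) * g 0 0,
          (X 0 0 - X 1 1) / (g 0 0 - g 1 1), ?_⟩
        ext i j
        fin_cases i <;> fin_cases j
        · simp
        · simp [hq, hy]
        · simp [hr, hz]
        · simp
          field_simp
          ring
      · -- g 1 0 ≠ 0: same as the second case
        refine ⟨X 0 0 - X 1 0 / g 1 0 * g 0 0, X 1 0 / g 1 0, ?_⟩
        ext i j
        fin_cases i <;> fin_cases j
        · simp
        · simp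
          field_simp
          linear_combination h00
        · simp [hr]
        · simp
          field_simp
          linear_combination h10
    · refine ⟨X 0 0 - X 0 1 / g 0 1 * g 0 0, X 0 1 / g 0 1, ?_⟩
      ext i j
      fin_cases i <;> fin_cases j
      · simp
      · simp [hq]
      · simp
        field_simp
        linear_combination -h00
      · simp
        field_simp
        linear_combination -h01

/-- **(D0)(ii).**  If `g` is non-scalar with SEPARABLE characteristic polynomial
(`(tr g)² − 4 det g ≠ 0`), then the only matrices commuting with `g` with the same trace and
determinant are `g` and its conjugate root `(tr g)•1 − g`.  (So `[N_L(C_L(g)) : C_L(g)] ≤ 2`.)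
False without separability: `λ•1 + b•N`, `N² = 0`, all commute with `λ•1 + N`. [folklore] -/
theorem fin_two_comm_same_charpoly {K : Type} [Field K] (g Y : Matrix (Fin 2) (Fin 2) K)
    (hg : g 0 1 ≠ 0 ∨ g 1 0 ≠ 0 ∨ g 0 0 ≠ g 1 1)
    (hsep : (g 0 0 + g 1 1) ^ 2 - 4 * g.det ≠ 0)
    (hY : Y * g = g * Y) (htr : Y.trace = g.trace) (hdet : Y.det = g.det) :
    Y = g ∨ Y = (g 0 0 + g 1 1) • (1 : Matrix (Fin 2) (Fin 2) K) - g := by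
  obtain ⟨a, b, rfl⟩ := fin_two_comm_exists_smul_add g Y hg hY
  rw [Matrix.trace_fin_two, Matrix.trace_fin_two] at htr
  rw [Matrix.det_fin_two, Matrix.det_fin_two] at hdet
  simp at htr hdet
  -- htr : a + b * g 0 0 + (a + b * g 1 1) = g 0 0 + g 1 1
  -- hdet : (a + b * g 0 0) * (a + b * g 1 1) - b * g 0 1 * (b * g 1 0) = g 0 0 * g 1 1 - g 0 1 * g 1 0
  rw [Matrix.det_fin_two] at hsep
  have key : (1 - b) * (1 + b) * ((g 0 0 + g 1 1) ^ 2 - 4 * (g 0 0 * g 1 1 - g 0 1 * g 1 0)) = 0 := by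
    linear_combination (4 : K) * hdet - (2 * a + (g 0 0 + g 1 1) + b * (g 0 0 + g 1 1)) * htr
  rcases mul_eq_zero.mp key with hb | hΔ
  swap
  · exact absurd hΔ hsep
  rcases mul_eq_zero.mp hb with hb | hb
  · have hb1 : b = 1 := by linear_combination -hb
    subst hb1
    have ha : a * (a + (g 0 0 + g 1 1)) = 0 := by linear_combination hdet
    have h2a : (2 : K) * a = 0 := by linear_combination htr
    rcases mul_eq_zero.mp h2a with h2K | ha0
    · -- characteristic 2
      rcases mul_eq_zero.mp ha with ha0 | hat
      · left
        subst ha0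
        simp
      · right
        have ha' : a = g 0 0 + g 1 1 := by linear_combination hat - (g 0 0 + g 1 1) * h2K
        have h1 : (1 : K) = -1 := by linear_combination h2K
        rw [ha', sub_eq_add_neg, ← neg_one_smul K g, ← h1]
    · left
      subst ha0
      simp
  · have hb1 : b = -1 := by linear_combination hb
    subst hb1
    have ha : a * (a - (g 0 0 + g 1 1)) = 0 := by linear_combination hdet
    have h2a : (2 : K) * (a - (g 0 0 + g 1 1)) = 0 := by linear_combination htr
    rcases mul_eq_zero.mp ha with ha0 | hat
    · subst ha0
      rcases mul_eq_zero.mp h2a with h2K | ht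
      · left
        have h1 : (1 : K) = -1 := by linear_combination h2K
        rw [zero_smul, zero_add, ← h1, one_smul]
      · right
        have ht' : g 0 0 + g 1 1 = 0 := by linear_combination -ht
        rw [ht', zero_smul, zero_add, zero_sub, neg_one_smul]
    · right
      have hat' : a = g 0 0 + g 1 1 := by linear_combination hat
      rw [hat', neg_one_smul, sub_eq_add_neg]

/-- Three-roots trick: at most two elements of a field satisfy a monic quadratic equation.
[folklore] -/
theorem fin_two_card_quadratic_le_two {K : Type} [Field K] [DecidableEq K] (β γ : K)
    (S : Finset K) (hS : ∀ a ∈ S, a * a + β * a + γ = 0) : S.card ≤ 2 := by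
  by_contra h
  rw [not_le, Finset.two_lt_card_iff] at h
  obtain ⟨a₁, a₂, a₃, h₁, h₂, h₃, h12, h13, h23⟩ := h
  have e₁ := hS a₁ h₁
  have e₂ := hS a₂ h₂
  have e₃ := hS a₃ h₃
  have f12 : (a₁ - a₂) * (a₁ + a₂ + β) = 0 := by linear_combination e₁ - e₂
  have f13 : (a₁ - a₃) * (a₁ + a₃ + β) = 0 := by linear_combination e₁ - e₃
  rcases mul_eq_zero.mp f12 with g12 | g12
  · exact h12 (sub_eq_zero.mp g12)
  rcases mul_eq_zero.mp f13 with g13 | g13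
  · exact h13 (sub_eq_zero.mp g13)
  exact h23 (by linear_combination g12 - g13)

/-- **(D0)(i).**  A finite set of determinant-one `2 × 2` matrices commuting with a non-scalar
matrix `g` has at most `2|K|` elements: each is `a•1 + b•g`, and for fixed `b` the condition
`det (a•1 + b•g) = 1` is a monic quadratic in `a`. [folklore] -/
theorem card_comm_det_one_le {K : Type} [Field K] [Fintype K] [DecidableEq K]
    (g : Matrix (Fin 2) (Fin 2) K) (hg : g 0 1 ≠ 0 ∨ g 1 0 ≠ 0 ∨ g 0 0 ≠ g 1 1)
    (C : Finset (Matrix (Fin 2) (Fin 2) K))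
    (hC : ∀ x ∈ C, x * g = g * x ∧ x.det = 1) :
    C.card ≤ 2 * Fintype.card K := by
  have hdet : ∀ a b : K, (a • (1 : Matrix (Fin 2) (Fin 2) K) + b • g).det =
      (a + b * g 0 0) * (a + b * g 1 1) - (b * g 0 1) * (b * g 1 0) := by
    intro a b
    rw [Matrix.det_fin_two]
    simp
  have hsurj : Set.SurjOn (fun ab : K × K => ab.1 • (1 : Matrix (Fin 2) (Fin 2) K) + ab.2 • g)
      ↑((Finset.univ : Finset (K × K)).filter
        (fun ab => (ab.1 • (1 : Matrix (Fin 2) (Fin 2) K) + ab.2 • g).det = 1)) ↑C := by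
    intro x hx
    obtain ⟨a, b, hab⟩ := fin_two_comm_exists_smul_add g x hg (hC x hx).1
    refine ⟨(a, b), ?_, hab.symm⟩
    rw [Finset.coe_filter]
    refine ⟨Finset.mem_univ _, ?_⟩
    rw [← hab]
    exact (hC x hx).2
  refine (Finset.card_le_card_of_surjOn _ hsurj).trans ?_
  rw [Finset.card_eq_sum_card_fiberwise (f := fun ab : K × K => ab.2) (t := Finset.univ)
    (fun _ _ => Finset.mem_univ _)]
  have hfib : ∀ b ∈ (Finset.univ : Finset K),
      (((Finset.univ : Finset (K × K)).filter
        (fun ab => (ab.1 • (1 : Matrix (Fin 2) (Fin 2) K) + ab.2 • g).det = 1)).filter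
        (fun ab : K × K => ab.2 = b)).card ≤ 2 := by
    intro b _
    have hinj : Set.InjOn (fun ab : K × K => ab.1)
        ↑((((Finset.univ : Finset (K × K)).filter
          (fun ab => (ab.1 • (1 : Matrix (Fin 2) (Fin 2) K) + ab.2 • g).det = 1)).filter
          (fun ab : K × K => ab.2 = b))) := by
      intro p hp p' hp' h
      rw [Finset.coe_filter] at hp hp'
      exact Prod.ext h (hp.2.trans hp'.2.symm)
    rw [← Finset.card_image_of_injOn hinj]
    refine fin_two_card_quadratic_le_two (b * (g 0 0 + g 1 1))
      (b * b * (g 0 0 * g 1 1 - g 0 1 * g 1 0) - 1) _ ?_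
    intro a ha
    rw [Finset.mem_image] at ha
    obtain ⟨p, hp, rfl⟩ := ha
    rw [Finset.mem_filter, Finset.mem_filter] at hp
    obtain ⟨⟨-, hp1⟩, hp2⟩ := hp
    rw [hdet, hp2] at hp1
    linear_combination hp1
  refine (Finset.sum_le_sum hfib).trans ?_
  rw [Finset.sum_const, Finset.card_univ, smul_eq_mul, mul_comm]

end Summit.MatrixMultiplication.MatrixMultiplication.Theorems.GradedDesignFamily.Negative
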